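import Summits.Ventures.CertifiedArithmetic.LowPrec.PatternEnvelopeMul

/-!
# Pattern route of Theorem E5, part 4: realisable and placeable SUM patterns — the table
# constants of the addition tables as a proved algorithm

HONEST FRAMING (venture CertifiedArithmetic / cell `pub-lowprec`): certified error envelopes and
provably optimal rounding/accumulation schemes for low-precision formats under stated cost models;
every table by two implementations; no hardware or vendor claims.

THEOREMS-R1 Theorem E5 (sec. 3 of `THEOREMS-R1.md`), bookkeeping half, for the SUM tables
`X + Y → R` (any three binary formats). With `d_X = qexp_X - qexp_R` (`expOffset`), a datum `a`
of `X` is `± k₁ · 2^(e₁) · quantum_R`, `e₁ = j₁ + d_X`, `(k₁, j₁) = (sig a, bshift a) ∈ sigShiftsC X`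
(canonical pairs, each magnitude once, zero included),
and likewise `b`; aligning at `e₀ = min e₁ e₂` the exact sum is
`a + b = ± Z · 2^(e₀) · quantum_R`, `Z = k₁ 2^(e₁-e₀) ± k₂ 2^(e₂-e₀)` (minus iff the operand
signs differ: `alignedZ`, `signedSum_eq`), so `|a + b| = N · 2^(e₀) · quantum_R` with the SUM
PATTERN `N = |Z|` (`addPatN`, `abs_add_toRat_eq`); `N < 2^(addFuel X Y)` (`addPatN_lt_pow`).
Conversely every `(k₁, j₁, k₂, j₂, opp)` with `N ≠ 0` is REALISED by data whose sum has either
prescribed sign (`exists_data_add`). The TABLE CONSTANTS are the maxima of the closed-form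
pattern errors of `PatternBridge.lean` over the realisable-and-placeable sum patterns
(`addPatErrs`; `envconstAddNE`, `envconstAddTZ`, `envconstAddDir` — one directed constant for
round down and round up, per pattern `max(toward-zero, away)`, both signs being realisable).
PROVED for every `X, Y, R` as SCHEMAS over a rounding with a pattern bridge: SOUNDNESS
(`add_rel_le_of_bridge`: on the normal range of `R`, `|fl(a+b) - (a+b)| ≤ c · |a+b|`) and
ATTAINMENT (`add_rel_attained_of_bridge`); `PatternEnvelopeAddModes.lean` instantiates the four
roundings and `PatternEnvelopeAddFP6FP4.lean` decides the FP6/FP4 sum constants without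
operand-pair enumeration. With `PatternEnvelopeMul*.lean` this makes the third-route evaluator
`code/enum/envconst.py` (pre-registered `certs/enum/PREDICTIONS-ENVCONST*.json`) a proved
algorithm for both operations.

Placement: venture development under `Summits/Ventures/CertifiedArithmetic/`; declarations extend
the Literature structures `Format` / `MiniFloat` (CONVENTIONS §2). New work of the venture
(elementary; [folklore] tags, cf. [cite: Higham2002ASNA, §2.1]).
-/

namespace Literature.ComputerArithmetic.FloatingPoint

namespace Format

/-- CANONICAL significand / shift pairs `(k, j)`: `j = 0` with `k < 2^(m+1)` (zero, subnormals,
first normal binade) or `j ≥ 1` with `2^m ≤ k < 2^(m+1)`, and `k · 2^j ≤ maxScaled` — exactly the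
pairs `(sig a, bshift a)` of the data, each magnitude listed once (a sub-list of `sigShifts`).
[cite: Higham2002ASNA, §2.1] -/
def sigShiftsC (φ : Format) : List (ℕ × ℕ) :=
  (List.range (2 ^ (φ.manBits + 1))).flatMap fun k =>
    (List.range (φ.emaxCode - 1 + 1)).flatMap fun j =>
      if k * 2 ^ j ≤ φ.maxScaled ∧ (j = 0 ∨ 2 ^ φ.manBits ≤ k) then [(k, j)] else []

/-- Membership in `sigShiftsC`. [folklore] -/
theorem mem_sigShiftsC {φ : Format} {k j : ℕ} : (k, j) ∈ φ.sigShiftsC ↔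
    k < 2 ^ (φ.manBits + 1) ∧ j ≤ φ.emaxCode - 1 ∧ k * 2 ^ j ≤ φ.maxScaled ∧
      (j = 0 ∨ 2 ^ φ.manBits ≤ k) := by
  simp only [sigShiftsC, List.mem_flatMap, List.mem_range]
  constructor
  · rintro ⟨k', hk', j', hj', h⟩
    split_ifs at h with hc
    · simp only [List.mem_singleton, Prod.mk.injEq] at h
      obtain ⟨rfl, rfl⟩ := h
      exact ⟨hk', by omega, hc.1, hc.2⟩
    · simp at h
  · rintro ⟨hk, hj, hle, hc⟩
    exact ⟨k, hk, j, by omega, by rw [if_pos ⟨hle, hc⟩]; simp⟩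

end Format

open Format

/-- The pair `(sig a, bshift a)` of a datum is canonical. [folklore] -/
theorem MiniFloat.bshift_eq_zero_or_le_sig {φ : Format} (x : MiniFloat φ) :
    x.bshift = 0 ∨ 2 ^ φ.manBits ≤ x.sig := by
  by_cases h : x.expCode = 0
  · left; simp [MiniFloat.bshift, h]
  · right; simp [MiniFloat.sig, h]

/-- The pair `(sig a, bshift a)` of a datum is listed in `sigShiftsC`. [folklore] -/
theorem MiniFloat.mem_sigShiftsC {φ : Format} (x : MiniFloat φ) : (x.sig, x.bshift) ∈ φ.sigShiftsC :=
  Format.mem_sigShiftsC.mpr ⟨x.sig_lt, x.bshift_le, x.sig_mul_pow_le_maxScaled,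
    x.bshift_eq_zero_or_le_sig⟩

/-- EXPONENT OFFSET of an operand format relative to the destination:
`quantum_X = 2^d · quantum_R`, `d = qexp_X - qexp_R`. [folklore] -/
def expOffset (X R : Format) : ℤ := X.qexp - R.qexp

/-- `quantum_X = 2^(expOffset X R) · quantum_R`. [folklore] -/
theorem quantum_eq_zpow_mul (X R : Format) : X.quantum = 2 ^ expOffset X R * R.quantum := by
  unfold Format.quantum expOffset
  rw [← zpow_add₀ (by norm_num : (2 : ℚ) ≠ 0)]
  congr 1
  ring

/-- SIGNED SUM `± k₁ · 2^e₁ ± k₂ · 2^e₂` (in quanta of the destination). [folklore] -/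
def signedSum (na : Bool) (k₁ : ℕ) (e₁ : ℤ) (nb : Bool) (k₂ : ℕ) (e₂ : ℤ) : ℚ :=
  (if na then -((k₁ : ℚ) * 2 ^ e₁) else (k₁ : ℚ) * 2 ^ e₁) +
    (if nb then -((k₂ : ℚ) * 2 ^ e₂) else (k₂ : ℚ) * 2 ^ e₂)

/-- ALIGNED SIGNIFICAND of a sum: with `e₀ = min e₁ e₂`, the integer
`k₁ · 2^(e₁ - e₀) ± k₂ · 2^(e₂ - e₀)`, minus iff the operand signs differ (`opp`). [folklore] -/
def alignedZ (k₁ : ℕ) (e₁ : ℤ) (k₂ : ℕ) (e₂ : ℤ) (opp : Bool) : ℤ :=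
  ((k₁ * 2 ^ (e₁ - min e₁ e₂).toNat : ℕ) : ℤ) +
    (if opp then -(((k₂ * 2 ^ (e₂ - min e₁ e₂).toNat : ℕ) : ℤ))
      else ((k₂ * 2 ^ (e₂ - min e₁ e₂).toNat : ℕ) : ℤ))

/-- SUM PATTERN `N = |alignedZ|`: `|a + b| = N · 2^(e₀) · quantum_R`. [folklore] -/
def addPatN (k₁ : ℕ) (e₁ : ℤ) (k₂ : ℕ) (e₂ : ℤ) (opp : Bool) : ℕ :=
  (alignedZ k₁ e₁ k₂ e₂ opp).natAbs

/-- `2^e = 2^(e - e₀) · 2^(e₀)` for `e₀ ≤ e`. [folklore] -/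
theorem zpow_eq_pow_toNat_mul {e e₀ : ℤ} (h : e₀ ≤ e) :
    (2 : ℚ) ^ e = 2 ^ (e - e₀).toNat * 2 ^ e₀ := by
  rw [← zpow_natCast, ← zpow_add₀ (by norm_num : (2 : ℚ) ≠ 0), Int.toNat_of_nonneg (by omega)]
  congr 1
  ring

/-- ALIGNMENT IDENTITY: `signedSum = (±1) · alignedZ · 2^(min e₁ e₂)`, the sign that of the first
operand and the aligned significand taken with `opp = (na ≠ nb)`. [folklore] -/
theorem signedSum_eq (na nb : Bool) (k₁ k₂ : ℕ) (e₁ e₂ : ℤ) :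
    signedSum na k₁ e₁ nb k₂ e₂ =
      (if na then -1 else 1) * ((alignedZ k₁ e₁ k₂ e₂ (xor na nb) : ℤ) : ℚ) * 2 ^ (min e₁ e₂) := by
  have he₁ := zpow_eq_pow_toNat_mul (min_le_left e₁ e₂)
  have he₂ := zpow_eq_pow_toNat_mul (min_le_right e₁ e₂)
  unfold signedSum alignedZ
  rw [he₁, he₂]
  cases na <;> cases nb <;> simp <;> ring

/-- `|signedSum| = addPatN · 2^(min e₁ e₂)`. [folklore] -/
theorem abs_signedSum_eq (na nb : Bool) (k₁ k₂ : ℕ) (e₁ e₂ : ℤ) :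
    |signedSum na k₁ e₁ nb k₂ e₂| = (addPatN k₁ e₁ k₂ e₂ (xor na nb) : ℚ) * 2 ^ (min e₁ e₂) := by
  rw [signedSum_eq, abs_mul, abs_mul, abs_of_pos (zpow_pos (by norm_num : (0 : ℚ) < 2) _),
    addPatN, Nat.cast_natAbs, Int.cast_abs]
  have h1 : |(if na = true then (-1 : ℚ) else 1)| = 1 := by split <;> simp
  rw [h1, one_mul]

/-- Sign of `signedSum`: that of `(±1) · alignedZ`. [folklore] -/
theorem signedSum_neg_iff (na nb : Bool) (k₁ k₂ : ℕ) (e₁ e₂ : ℤ) :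
    signedSum na k₁ e₁ nb k₂ e₂ < 0 ↔
      (if na then -1 else 1) * ((alignedZ k₁ e₁ k₂ e₂ (xor na nb) : ℤ) : ℚ) < 0 := by
  rw [signedSum_eq]
  have hp : (0 : ℚ) < 2 ^ (min e₁ e₂) := zpow_pos (by norm_num) _
  constructor
  · intro h
    by_contra hc
    exact absurd h (not_lt.mpr (mul_nonneg (not_lt.mp hc) hp.le))
  · intro h
    exact mul_neg_of_neg_of_pos h hp

/-- FUEL for the binade search on sum patterns: `N < 2^(addFuel X Y)` for every realisable
pattern (`addPatN_lt_pow`). [folklore] -/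
def addFuel (X Y : Format) : ℕ :=
  X.manBits + X.emaxCode + Y.manBits + Y.emaxCode + 2 * (X.qexp - Y.qexp).natAbs + 2

/-- `2^a + 2^b ≤ 2^(a+b)` for `a, b ≥ 1`. [folklore] -/
theorem two_pow_add_two_pow_le {a b : ℕ} (ha : 1 ≤ a) (hb : 1 ≤ b) :
    2 ^ a + 2 ^ b ≤ 2 ^ (a + b) := by
  rw [pow_add]
  have h2a : 2 ≤ 2 ^ a := by
    calc 2 = 2 ^ 1 := by norm_num
      _ ≤ 2 ^ a := Nat.pow_le_pow_right (by norm_num) ha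
  have h2b : 2 ≤ 2 ^ b := by
    calc 2 = 2 ^ 1 := by norm_num
      _ ≤ 2 ^ b := Nat.pow_le_pow_right (by norm_num) hb
  nlinarith

/-- An aligned operand is below `2^(m + 1 + emaxCode + D)`, `D = |qexp_X - qexp_Y|`. [folklore] -/
theorem aligned_lt_pow {X Y R : Format} {k j j' : ℕ} (hk : k < 2 ^ (X.manBits + 1))
    (hj : j ≤ X.emaxCode - 1) :
    k * 2 ^ (((j : ℤ) + expOffset X R) -
        min ((j : ℤ) + expOffset X R) ((j' : ℤ) + expOffset Y R)).toNat
      < 2 ^ (X.manBits + 1 + X.emaxCode + (X.qexp - Y.qexp).natAbs) := by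
  have hg : (((j : ℤ) + expOffset X R) -
      min ((j : ℤ) + expOffset X R) ((j' : ℤ) + expOffset Y R)).toNat
        ≤ X.emaxCode + (X.qexp - Y.qexp).natAbs := by
    unfold expOffset
    omega
  calc k * 2 ^ _ < 2 ^ (X.manBits + 1) * 2 ^ (X.emaxCode + (X.qexp - Y.qexp).natAbs) :=
        Nat.mul_lt_mul_of_lt_of_le hk (Nat.pow_le_pow_right (by norm_num) hg) (Nat.two_pow_pos _)
    _ = 2 ^ (X.manBits + 1 + X.emaxCode + (X.qexp - Y.qexp).natAbs) := by
        rw [← pow_add]; congr 1; omega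

/-- FUEL BOUND: a realisable sum pattern is below `2^(m_R + 1 + addFuel X Y)`. [folklore] -/
theorem addPatN_lt_pow {X Y : Format} (R : Format) {k₁ j₁ k₂ j₂ : ℕ}
    (h1 : (k₁, j₁) ∈ X.sigShiftsC) (h2 : (k₂, j₂) ∈ Y.sigShiftsC) (opp : Bool) :
    addPatN k₁ ((j₁ : ℤ) + expOffset X R) k₂ ((j₂ : ℤ) + expOffset Y R) opp
      < 2 ^ (R.manBits + 1 + addFuel X Y) := by
  obtain ⟨hk1, hj1, -, -⟩ := mem_sigShiftsC.mp h1
  obtain ⟨hk2, hj2, -, -⟩ := mem_sigShiftsC.mp h2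
  have hA := aligned_lt_pow (X := X) (Y := Y) (R := R) (j' := j₂) hk1 hj1
  have hB := aligned_lt_pow (X := Y) (Y := X) (R := R) (j' := j₁) hk2 hj2
  rw [min_comm] at hB
  have hD : (Y.qexp - X.qexp).natAbs = (X.qexp - Y.qexp).natAbs := by omega
  rw [hD] at hB
  have hle : addPatN k₁ ((j₁ : ℤ) + expOffset X R) k₂ ((j₂ : ℤ) + expOffset Y R) opp ≤
      k₁ * 2 ^ (((j₁ : ℤ) + expOffset X R) -
          min ((j₁ : ℤ) + expOffset X R) ((j₂ : ℤ) + expOffset Y R)).toNat +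
        k₂ * 2 ^ (((j₂ : ℤ) + expOffset Y R) -
          min ((j₁ : ℤ) + expOffset X R) ((j₂ : ℤ) + expOffset Y R)).toNat := by
    unfold addPatN alignedZ
    cases opp
    · simp only [Bool.false_eq_true, if_false]; omega
    · simp only [if_true]; omega
  calc _ ≤ _ := hle
    _ < 2 ^ (X.manBits + 1 + X.emaxCode + (X.qexp - Y.qexp).natAbs) +
          2 ^ (Y.manBits + 1 + Y.emaxCode + (X.qexp - Y.qexp).natAbs) := by omega
    _ ≤ 2 ^ ((X.manBits + 1 + X.emaxCode + (X.qexp - Y.qexp).natAbs) +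
          (Y.manBits + 1 + Y.emaxCode + (X.qexp - Y.qexp).natAbs)) :=
        two_pow_add_two_pow_le (by omega) (by omega)
    _ = 2 ^ addFuel X Y := by unfold addFuel; congr 1; omega
    _ ≤ 2 ^ (R.manBits + 1 + addFuel X Y) := Nat.pow_le_pow_right (by norm_num) (by omega)

/-- THE REALISABLE-AND-PLACEABLE SUM PATTERNS with their errors: for every
`(k₁, j₁) ∈ sigShiftsC X`, `(k₂, j₂) ∈ sigShiftsC Y` and sign relation `opp`, with
`N = addPatN k₁ e₁ k₂ e₂ opp` placeable at `min e₁ e₂` (`eᵢ = jᵢ + d`), the pattern error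
`err R (addFuel X Y) N`. [folklore] -/
def addPatErrs (err : Format → ℕ → ℕ → ℚ) (X Y R : Format) : List ℚ :=
  X.sigShiftsC.flatMap fun p => Y.sigShiftsC.flatMap fun q => [false, true].flatMap fun opp =>
    if R.placedB (addPatN p.1 ((p.2 : ℤ) + expOffset X R) q.1 ((q.2 : ℤ) + expOffset Y R) opp)
        (min ((p.2 : ℤ) + expOffset X R) ((q.2 : ℤ) + expOffset Y R)) then
      [err R (addFuel X Y)
        (addPatN p.1 ((p.2 : ℤ) + expOffset X R) q.1 ((q.2 : ℤ) + expOffset Y R) opp)]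
    else []

/-- Membership in `addPatErrs`. [folklore] -/
theorem mem_addPatErrs {err : Format → ℕ → ℕ → ℚ} {X Y R : Format} {c : ℚ} :
    c ∈ addPatErrs err X Y R ↔ ∃ (k₁ j₁ k₂ j₂ : ℕ) (opp : Bool), (k₁, j₁) ∈ X.sigShiftsC ∧
      (k₂, j₂) ∈ Y.sigShiftsC ∧
      R.placedB (addPatN k₁ ((j₁ : ℤ) + expOffset X R) k₂ ((j₂ : ℤ) + expOffset Y R) opp)
        (min ((j₁ : ℤ) + expOffset X R) ((j₂ : ℤ) + expOffset Y R)) = true ∧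
      c = err R (addFuel X Y)
        (addPatN k₁ ((j₁ : ℤ) + expOffset X R) k₂ ((j₂ : ℤ) + expOffset Y R) opp) := by
  simp only [addPatErrs, List.mem_flatMap]
  constructor
  · rintro ⟨⟨k₁, j₁⟩, h1, ⟨k₂, j₂⟩, h2, opp, -, h⟩
    split_ifs at h with hp
    · exact ⟨k₁, j₁, k₂, j₂, opp, h1, h2, hp, by simpa using h⟩
    · simp at h
  · rintro ⟨k₁, j₁, k₂, j₂, opp, h1, h2, hp, rfl⟩
    exact ⟨(k₁, j₁), h1, (k₂, j₂), h2, opp, by cases opp <;> simp, by rw [if_pos hp]; simp⟩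

/-- TABLE CONSTANT, sums, round to nearest: the largest placeable pattern error. [folklore] -/
def envconstAddNE (X Y R : Format) : ℚ := maxList0 (addPatErrs patRelErrNE X Y R)

/-- TABLE CONSTANT, sums, toward zero. [folklore] -/
def envconstAddTZ (X Y R : Format) : ℚ := maxList0 (addPatErrs patRelErrTZ X Y R)

/-- TABLE CONSTANT, sums, round down / round up (one constant for both columns). [folklore] -/
def envconstAddDir (X Y R : Format) : ℚ := maxList0 (addPatErrs patRelErrDir X Y R)

namespace MiniFloat

variable {X Y : Format}

/-- A DATUM IN SIGNED PATTERN FORM relative to `R`: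
`a = ± sig a · 2^(bshift a + d_X) · quantum_R`. [folklore] -/
theorem toRat_eq_signed (R : Format) (a : MiniFloat X) :
    a.toRat = (if a.neg then -((a.sig : ℚ) * 2 ^ ((a.bshift : ℤ) + expOffset X R))
      else (a.sig : ℚ) * 2 ^ ((a.bshift : ℤ) + expOffset X R)) * R.quantum := by
  unfold toRat toInt
  rw [scaledMag_eq_sig_mul_pow, quantum_eq_zpow_mul X R,
    zpow_add₀ (by norm_num : (2 : ℚ) ≠ 0), zpow_natCast]
  push_cast
  split <;> ring

/-- SUM OF TWO DATA = `signedSum · quantum_R`. [folklore] -/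
theorem add_toRat_eq_signedSum (R : Format) (a : MiniFloat X) (b : MiniFloat Y) :
    a.toRat + b.toRat = signedSum a.neg a.sig ((a.bshift : ℤ) + expOffset X R)
      b.neg b.sig ((b.bshift : ℤ) + expOffset Y R) * R.quantum := by
  rw [toRat_eq_signed R a, toRat_eq_signed R b, signedSum]
  ring

/-- SUM OF TWO DATA IN PATTERN FORM: `|a + b| = N · 2^(e₀) · quantum_R` with `N = addPatN …`
at `opp = (a.neg ≠ b.neg)` and `e₀ = min e₁ e₂`. [folklore] -/
theorem abs_add_toRat_eq (R : Format) (a : MiniFloat X) (b : MiniFloat Y) :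
    |a.toRat + b.toRat| = (addPatN a.sig ((a.bshift : ℤ) + expOffset X R) b.sig
        ((b.bshift : ℤ) + expOffset Y R) (xor a.neg b.neg) : ℚ) *
      2 ^ (min ((a.bshift : ℤ) + expOffset X R) ((b.bshift : ℤ) + expOffset Y R))
        * R.quantum := by
  rw [add_toRat_eq_signedSum R a b, abs_mul, abs_of_pos R.quantum_pos, abs_signedSum_eq]

/-- The pattern of a sum in the normal range of `R` is listed. [folklore] -/
theorem mem_addPatErrs_of_normal (err : Format → ℕ → ℕ → ℚ) (R : Format) (a : MiniFloat X)
    (b : MiniFloat Y) (hlo : 2 ^ R.manBits * R.quantum ≤ |a.toRat + b.toRat|)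
    (hhi : |a.toRat + b.toRat| ≤ R.maxRat) :
    err R (addFuel X Y) (addPatN a.sig ((a.bshift : ℤ) + expOffset X R) b.sig
        ((b.bshift : ℤ) + expOffset Y R) (xor a.neg b.neg)) ∈ addPatErrs err X Y R := by
  rw [mem_addPatErrs]
  exact ⟨a.sig, a.bshift, b.sig, b.bshift, xor a.neg b.neg, a.mem_sigShiftsC, b.mem_sigShiftsC,
    (placedB_iff_of_eq (abs_add_toRat_eq R a b)).mpr ⟨hlo, hhi⟩, rfl⟩

/-- SOUNDNESS SCHEMA (sums): a rounding whose normal-range relative error at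
`|t| = N · 2^e · quantum_R` is at most `err R F N` has all its sum errors below
`maxList0 (addPatErrs err X Y R) · |a+b|`. [folklore] -/
theorem add_rel_le_of_bridge (R : Format) (fl : ℚ → MiniFloat R) (err : Format → ℕ → ℕ → ℚ)
    (hbridge : ∀ (t : ℚ) (N : ℕ) (e : ℤ), N < 2 ^ (R.manBits + 1 + addFuel X Y) →
      |t| = (N : ℚ) * 2 ^ e * R.quantum → 2 ^ R.manBits * R.quantum ≤ |t| → |t| ≤ R.maxRat →
        |t - (fl t).toRat| / |t| ≤ err R (addFuel X Y) N)
    (a : MiniFloat X) (b : MiniFloat Y) (hlo : 2 ^ R.manBits * R.quantum ≤ |a.toRat + b.toRat|)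
    (hhi : |a.toRat + b.toRat| ≤ R.maxRat) :
    |(fl (a.toRat + b.toRat)).toRat - (a.toRat + b.toRat)|
      ≤ maxList0 (addPatErrs err X Y R) * |a.toRat + b.toRat| := by
  have hpos : 0 < |a.toRat + b.toRat| := abs_pos.mpr (ne_zero_of_normal hlo)
  have hrel := hbridge _ _ _ (addPatN_lt_pow R a.mem_sigShiftsC b.mem_sigShiftsC (xor a.neg b.neg))
    (abs_add_toRat_eq R a b) hlo hhi
  exact abs_sub_le_mul_of_relErr_le hpos
    (le_trans hrel (le_maxList0_of_mem (mem_addPatErrs_of_normal err R a b hlo hhi)))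

/-- `ofScaled` data in signed pattern form relative to `R`. [folklore] -/
theorem toRat_ofScaled_signed (R : Format) {na : Bool} {k j : ℕ} (hn : k * 2 ^ j ≤ X.maxScaled)
    (hk : k < 2 ^ (X.manBits + 1)) :
    (ofScaled X na (k * 2 ^ j) hn).toRat = (if na then -((k : ℚ) * 2 ^ ((j : ℤ) + expOffset X R))
      else (k : ℚ) * 2 ^ ((j : ℤ) + expOffset X R)) * R.quantum := by
  rw [toRat_ofScaled hn (representable_mul_pow hk hn), quantum_eq_zpow_mul X R,
    zpow_add₀ (by norm_num : (2 : ℚ) ≠ 0), zpow_natCast]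
  push_cast
  split <;> ring

/-- REALISATION (sums): every listed pattern with `N ≠ 0` is the sum pattern of two data whose
sum has either prescribed sign. [folklore] -/
theorem exists_data_add (R : Format) {k₁ j₁ k₂ j₂ : ℕ} (h1 : (k₁, j₁) ∈ X.sigShiftsC)
    (h2 : (k₂, j₂) ∈ Y.sigShiftsC) (opp neg : Bool)
    (hN : addPatN k₁ ((j₁ : ℤ) + expOffset X R) k₂ ((j₂ : ℤ) + expOffset Y R) opp ≠ 0) :
    ∃ (a : MiniFloat X) (b : MiniFloat Y),
      |a.toRat + b.toRat| = (addPatN k₁ ((j₁ : ℤ) + expOffset X R) k₂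
          ((j₂ : ℤ) + expOffset Y R) opp : ℚ) *
        2 ^ (min ((j₁ : ℤ) + expOffset X R) ((j₂ : ℤ) + expOffset Y R)) * R.quantum ∧
      (a.toRat + b.toRat < 0 ↔ neg = true) := by
  obtain ⟨hk1, -, hle1, -⟩ := Format.mem_sigShiftsC.mp h1
  obtain ⟨hk2, -, hle2, -⟩ := Format.mem_sigShiftsC.mp h2
  set e₁ := (j₁ : ℤ) + expOffset X R with he₁
  set e₂ := (j₂ : ℤ) + expOffset Y R with he₂
  have hZ : alignedZ k₁ e₁ k₂ e₂ opp ≠ 0 := fun h => hN (by rw [addPatN, h]; rfl)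
  -- the data for a first-operand sign `na`; second sign `xor na opp`
  have hsum : ∀ na : Bool,
      (ofScaled X na (k₁ * 2 ^ j₁) hle1).toRat + (ofScaled Y (xor na opp) (k₂ * 2 ^ j₂) hle2).toRat
        = signedSum na k₁ e₁ (xor na opp) k₂ e₂ * R.quantum := by
    intro na
    rw [toRat_ofScaled_signed R hle1 hk1, toRat_ofScaled_signed R hle2 hk2, signedSum]
    ring
  have hxor : ∀ na : Bool, xor na (xor na opp) = opp := by intro na; cases na <;> cases opp <;> rfl
  have hq := R.quantum_pos
  have habs : ∀ na : Bool, |(ofScaled X na (k₁ * 2 ^ j₁) hle1).toRat +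
      (ofScaled Y (xor na opp) (k₂ * 2 ^ j₂) hle2).toRat| =
        (addPatN k₁ e₁ k₂ e₂ opp : ℚ) * 2 ^ (min e₁ e₂) * R.quantum := by
    intro na
    rw [hsum na, abs_mul, abs_of_pos hq, abs_signedSum_eq, hxor]
  have hsgn : ∀ na : Bool, (ofScaled X na (k₁ * 2 ^ j₁) hle1).toRat +
      (ofScaled Y (xor na opp) (k₂ * 2 ^ j₂) hle2).toRat < 0 ↔
        (if na then -1 else 1) * ((alignedZ k₁ e₁ k₂ e₂ opp : ℤ) : ℚ) < 0 := by
    intro na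
    have h0 := signedSum_neg_iff na (xor na opp) k₁ k₂ e₁ e₂
    rw [hxor] at h0
    rw [hsum na, ← h0]
    exact ⟨fun h => by
        by_contra hc
        exact absurd h (not_lt.mpr (mul_nonneg (not_lt.mp hc) hq.le)),
      fun h => mul_neg_of_neg_of_pos h hq⟩
  -- choose the first sign so that `(±1) · Z` has the prescribed sign
  rcases lt_or_gt_of_ne hZ with hlt | hgt
  · have hZq : ((alignedZ k₁ e₁ k₂ e₂ opp : ℤ) : ℚ) < 0 := by exact_mod_cast hlt
    refine ⟨_, _, habs (!neg), ?_⟩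
    rw [hsgn]
    cases neg <;> simp <;> linarith
  · have hZq : (0 : ℚ) < ((alignedZ k₁ e₁ k₂ e₂ opp : ℤ) : ℚ) := by exact_mod_cast hgt
    refine ⟨_, _, habs neg, ?_⟩
    rw [hsgn]
    cases neg <;> simp <;> linarith

/-- ATTAINMENT SCHEMA (sums): if the rounding's normal-range relative error at
`|t| = N · 2^e · quantum_R` EQUALS `err R F N` for `t` of the sign prescribed by `sgn N`, then
`maxList0 (addPatErrs err X Y R)` is attained by an in-range sum (once some pattern is
placeable). [folklore] -/
theorem add_rel_attained_of_bridge (R : Format) (fl : ℚ → MiniFloat R)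
    (err : Format → ℕ → ℕ → ℚ) (sgn : ℕ → Bool) (hnn : ∀ N, 0 ≤ err R (addFuel X Y) N)
    (hbridge : ∀ (t : ℚ) (N : ℕ) (e : ℤ), t ≠ 0 → (t < 0 ↔ sgn N = true) →
      N < 2 ^ (R.manBits + 1 + addFuel X Y) → |t| = (N : ℚ) * 2 ^ e * R.quantum →
        2 ^ R.manBits * R.quantum ≤ |t| → |t| ≤ R.maxRat →
          |t - (fl t).toRat| / |t| = err R (addFuel X Y) N)
    (hne : addPatErrs err X Y R ≠ []) :
    ∃ (a : MiniFloat X) (b : MiniFloat Y), 2 ^ R.manBits * R.quantum ≤ |a.toRat + b.toRat| ∧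
      |a.toRat + b.toRat| ≤ R.maxRat ∧
      |(fl (a.toRat + b.toRat)).toRat - (a.toRat + b.toRat)|
        = maxList0 (addPatErrs err X Y R) * |a.toRat + b.toRat| := by
  have hmem := maxList0_mem_of_ne_nil hne (fun c hc => by
    obtain ⟨k₁, j₁, k₂, j₂, opp, -, -, -, rfl⟩ := mem_addPatErrs.mp hc
    exact hnn _)
  obtain ⟨k₁, j₁, k₂, j₂, opp, h1, h2, hp, hc⟩ := mem_addPatErrs.mp hmem
  have hN := pos_of_placedB hp
  obtain ⟨a, b, ht, hsgn⟩ := exists_data_add R h1 h2 opp (sgn _) (Nat.pos_iff_ne_zero.mp hN)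
  have hrange := (placedB_iff_of_eq ht).mp hp
  have hne0 := ne_zero_of_normal hrange.1
  have hrel := hbridge _ _ _ hne0 hsgn (addPatN_lt_pow R h1 h2 opp) ht hrange.1 hrange.2
  refine ⟨a, b, hrange.1, hrange.2, ?_⟩
  rw [hc]
  exact abs_sub_eq_mul_of_relErr_eq (abs_pos.mpr hne0) hrel

end MiniFloat

end Literature.ComputerArithmetic.FloatingPoint
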